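import Summits.QuantumFields.GaugeBoot.WeakCouplingLimit
import Literature.MathematicalPhysics.QuantumLattice.LatticeGaugeDLRProofs
import Literature.RepresentationTheory.CompactGroups.UnitaryTrick
import HarnessLib

/-!
# Gauge-boot: peeling plaquettes off the torus — the fiberwise change of variables, the assigned
# links and layers, the peeling map (supplement 21, part 3c, file 1/2)

HONEST FRAMING (cell `pub-gaugeboot`, page 1 of every file): certified bounds on lattice
expectations at STATED coupling, gauge group, dimension and torus size; NOT a mass gap, NOT a
continuum limit, NOT a string tension, NOT large `N`; NOT Yang–Mills-summit-bearing (barriers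
`FixedCouplingUltralocality`, `PerturbativeInvisibility`).  A structural inequality for the Wave-0
torus partition function at `β ≥ 0`; it certifies no number.  Input of the `O(1/β)` bound (part 3e).

## Content

For a compact second-countable `G`, a continuous `ρ` (so `Re tr ρ ≤ N` and the plaquette weight
`f(g) = e^{−β(N − Re tr ρ(g))} ∈ (0, 1]` for `β ≥ 0`) and the torus `(ℤ/L)^d` with a marked axis `0`:

* `PiFiber.measurePreserving_fiberwise` — a GENERAL change of variables on a finite product of
  probability spaces: replacing the coordinates in a set `T` by `Φ_U(U_i)`, where each `Φ_U(·)` is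
  measure preserving and depends on `U` only through the coordinates OUTSIDE `T`, preserves the
  product measure (skew product over `T^c`);
* `Peel.assigned` — the links `(x, μ)` with `x₀ ≠ 0`, `μ ≠ 0` (`#assigned = (d−1)(L^d − L^{d−1})`,
  `Peel.card_assigned`); to each is assigned the plaquette `(x; 0, μ)`, injectively; the LAYER `k`
  consists of those with `x₀ = k`;
* `Peel.peelMap k` — replaces every layer-`k` link variable `U(x,μ)` by the inverse holonomy
  `U(x,μ) U(x+e_μ,0) U(x+e_0,μ)⁻¹ U(x,0)⁻¹` of its plaquette (a right translation by links outside the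
  layer): measure preserving (`measurePreserving_peelMap`), and it converts the layer-`k` plaquette
  weights into one-link weights without touching the other factors (`peelWeight_comp_peelMap`);
* `Peel.exp_neg_mul_wilsonAction_le_peelWeight_zero` — dropping the unassigned plaquettes (`f ≤ 1`):
  `e^{−βS} ≤ peelWeight 0` (the product of the assigned plaquette weights).

File 2/2 (`TorusPartitionUpperBound`) proves that the peeling maps preserve Haar measure and concludes
`∫ e^{−βS} dHaar^{⊗E} ≤ (∫_G f dHaar)^{#assigned}`.
[folklore] (the transfer-free "peeling" is the inequality form of the axial-gauge triangular change
of variables, e.g. S. Chatterjee, arXiv:1602.01222 §9; no gauge fixing is needed for the inequality.)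
-/

noncomputable section

open MeasureTheory Filter
open Literature.MathematicalPhysics.QuantumFieldTheory
open Literature.MathematicalPhysics.QuantumLattice (measurePreserving_mul_mul_inv_haarProbability)
open Literature.RepresentationTheory.CompactGroups

namespace Summit.QuantumFields.GaugeBoot

/-! ## A fiberwise change of variables on a finite product of probability spaces -/

namespace PiFiber

variable {ι X : Type*} [Fintype ι] [MeasurableSpace X]

/-- **Fiberwise measure-preserving coordinate changes preserve the product measure.**  Let `κ` be a
probability measure on `X`, `T ⊆ ι`, and `Φ U i : X → X` (`U : ι → X`, `i : ι`) measure preserving for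
every `U, i`, depending on `U` only through `U|_{T^c}`, with `U ↦ (i ↦ Φ U i (U i))` measurable.  Then
`U ↦ (i ↦ if i ∈ T then Φ U i (U i) else U i)` preserves `κ^{⊗ι}` (the dependence condition is only
needed for `i ∈ T`). [folklore] -/
theorem measurePreserving_fiberwise [Nonempty X] (κ : Measure X) [IsProbabilityMeasure κ] (T : Set ι)
    [DecidablePred (· ∈ T)] (Φ : (ι → X) → ι → X → X)
    (hdep : ∀ U U' : ι → X, (∀ i, i ∉ T → U i = U' i) → ∀ i, i ∈ T → Φ U i = Φ U' i)
    (hm : Measurable fun U : ι → X => fun i => Φ U i (U i))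
    (hpres : ∀ U i, MeasurePreserving (Φ U i) κ κ) :
    MeasurePreserving (fun (U : ι → X) (i : ι) => if i ∈ T then Φ U i (U i) else U i)
      (Measure.pi fun _ : ι => κ) (Measure.pi fun _ : ι => κ) := by
  classical
  set e := MeasurableEquiv.piEquivPiSubtypeProd (fun _ : ι => X) (· ∈ T) with he
  have hemp : MeasurePreserving e (Measure.pi fun _ : ι => κ)
      ((Measure.pi fun _ : {i // i ∈ T} => κ).prod (Measure.pi fun _ : {i // i ∉ T} => κ)) :=
    measurePreserving_piEquivPiSubtypeProd (fun _ : ι => κ) (· ∈ T)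
  -- the skew map on `(T^c → X) × (T → X)`
  set g : ({i // i ∉ T} → X) → ({i // i ∈ T} → X) → ({i // i ∈ T} → X) :=
    fun (a : {i // i ∉ T} → X) (b : {i // i ∈ T} → X) (i : {i // i ∈ T}) => Φ (e.symm (b, a)) (i : ι) (b i) with hg
  have hsymm_out : ∀ (b : {i // i ∈ T} → X) (a : {i // i ∉ T} → X) (i : ι) (hi : i ∉ T),
      e.symm (b, a) i = a ⟨i, hi⟩ := by
    intro b a i hi
    simp [he, MeasurableEquiv.piEquivPiSubtypeProd, hi]
  have hsymm_in : ∀ (b : {i // i ∈ T} → X) (a : {i // i ∉ T} → X) (i : ι) (hi : i ∈ T),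
      e.symm (b, a) i = b ⟨i, hi⟩ := by
    intro b a i hi
    simp [he, MeasurableEquiv.piEquivPiSubtypeProd, hi]
  obtain ⟨x₀⟩ := ‹Nonempty X›
  have hg_eq : ∀ a b, g a b = fun i : {i // i ∈ T} => Φ (e.symm (fun _ => x₀, a)) (i : ι) (b i) := by
    intro a b
    have hΦ : ∀ i : {i // i ∈ T}, Φ (e.symm (b, a)) i = Φ (e.symm (fun _ => x₀, a)) i := fun i =>
      hdep _ _ (fun j hj => by rw [hsymm_out b a j hj, hsymm_out _ a j hj]) i i.2
    funext i
    simp only [hg, hΦ i]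
  have hgm : Measurable (Function.uncurry g) := by
    have h1 : Function.uncurry g = (fun U : ι → X => fun i : {i // i ∈ T} => Φ U (i : ι) (U i)) ∘
        (fun p : ({i // i ∉ T} → X) × ({i // i ∈ T} → X) => e.symm (p.2, p.1)) := by
      funext p
      simp only [Function.uncurry, Function.comp, hg]
      funext i
      rw [hsymm_in p.2 p.1 i i.2]
    rw [h1]
    refine Measurable.comp ?_ (e.symm.measurable.comp measurable_swap)
    exact measurable_pi_lambda _ fun i => (measurable_pi_apply (i : ι)).comp hm
  have hskew : MeasurePreserving (fun p : ({i // i ∉ T} → X) × ({i // i ∈ T} → X) => (p.1, g p.1 p.2))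
      ((Measure.pi fun _ : {i // i ∉ T} => κ).prod (Measure.pi fun _ : {i // i ∈ T} => κ))
      ((Measure.pi fun _ : {i // i ∉ T} => κ).prod (Measure.pi fun _ : {i // i ∈ T} => κ)) := by
    refine (MeasurePreserving.id _).skew_product hgm (ae_of_all _ fun a => ?_)
    have hga : g a = fun (b : {i // i ∈ T} → X) (i : {i // i ∈ T}) => Φ (e.symm (fun _ => x₀, a)) (i : ι) (b i) :=
      funext fun b => hg_eq a b
    rw [hga]
    exact (measurePreserving_pi (fun _ : {i // i ∈ T} => κ) (fun _ : {i // i ∈ T} => κ)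
      (f := fun (i : {i // i ∈ T}) (v : X) => Φ (e.symm (fun _ => x₀, a)) (i : ι) v)
      (fun i => hpres (e.symm (fun _ => x₀, a)) (i : ι))).map_eq
  have hswap₁ : MeasurePreserving Prod.swap
      ((Measure.pi fun _ : {i // i ∈ T} => κ).prod (Measure.pi fun _ : {i // i ∉ T} => κ))
      ((Measure.pi fun _ : {i // i ∉ T} => κ).prod (Measure.pi fun _ : {i // i ∈ T} => κ)) :=
    Measure.measurePreserving_swap
  have hswap₂ : MeasurePreserving Prod.swap
      ((Measure.pi fun _ : {i // i ∉ T} => κ).prod (Measure.pi fun _ : {i // i ∈ T} => κ))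
      ((Measure.pi fun _ : {i // i ∈ T} => κ).prod (Measure.pi fun _ : {i // i ∉ T} => κ)) :=
    Measure.measurePreserving_swap
  have hcomp := (hemp.symm e).comp (hswap₂.comp (hskew.comp (hswap₁.comp hemp)))
  have hfun : (fun (U : ι → X) (i : ι) => if i ∈ T then Φ U i (U i) else U i) =
      e.symm ∘ Prod.swap ∘ (fun p : ({i // i ∉ T} → X) × ({i // i ∈ T} → X) => (p.1, g p.1 p.2)) ∘
        Prod.swap ∘ e := by
    funext U
    have heU : e U = (fun i : {i // i ∈ T} => U i, fun i : {i // i ∉ T} => U i) := rfl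
    have hsymm : e.symm (fun i : {i // i ∈ T} => U i, fun i : {i // i ∉ T} => U i) = U := by
      rw [← heU]; exact e.symm_apply_apply U
    simp only [Function.comp, heU, Prod.swap]
    funext i
    by_cases hi : i ∈ T
    · rw [if_pos hi, hsymm_in _ _ i hi]
      simp only [hg, hsymm]
    · rw [if_neg hi, hsymm_out _ _ i hi]
  rw [hfun]
  exact hcomp

end PiFiber

/-! ## Peeling the torus -/

namespace Peel

open Classical in
/-- The links `(x, μ)` with `x₀ ≠ 0` and `μ ≠ 0`: to each is assigned the plaquette `(x; 0, μ)`. -/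
def assigned (d L : ℕ) [NeZero d] [NeZero L] : Finset (Edge d L) :=
  (Finset.univ.filter fun x : Site d L => x 0 ≠ 0) ×ˢ (Finset.univ.filter fun μ : Fin d => μ ≠ 0)

/-- Layer `k`: the links `(x, μ)` with `x₀` of value `k` and `μ ≠ 0`. -/
def layer (d L : ℕ) [NeZero d] (k : ℕ) : Set (Edge d L) := {e | (e.1 0).val = k ∧ e.2 ≠ 0}

/-! ### Counting -/

section Count

variable {d L : ℕ} [NeZero d] [NeZero L]

/-- Membership in `assigned`. -/
theorem mem_assigned {e : Edge d L} : e ∈ assigned d L ↔ e.1 0 ≠ 0 ∧ e.2 ≠ 0 := by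
  simp [assigned, Finset.mem_product]

/-- Every fibre `{x : x₀ = a}` of the torus has `L^{d−1}` sites: `L · #{x : x₀ = a} = L^d`. [folklore] -/
theorem card_filter_apply_eq (a : ZMod L) :
    L * (Finset.univ.filter fun x : Site d L => x 0 = a).card = L ^ d := by
  classical
  -- all fibres have the same size (translation by `Pi.single 0 (b - a)`)
  have hfib : ∀ b : ZMod L, (Finset.univ.filter fun x : Site d L => x 0 = b).card =
      (Finset.univ.filter fun x : Site d L => x 0 = a).card := by
    intro b
    refine Finset.card_bij' (fun x _ => x + Pi.single 0 (a - b)) (fun x _ => x + Pi.single 0 (b - a)) ?_ ?_ ?_ ?_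
    · intro x hx
      simp only [Finset.mem_filter, Finset.mem_univ, true_and] at hx ⊢
      simp [hx]
    · intro x hx
      simp only [Finset.mem_filter, Finset.mem_univ, true_and] at hx ⊢
      simp [hx]
    · intro x _
      rw [add_assoc, ← Pi.single_add, sub_add_sub_cancel, sub_self, Pi.single_zero, add_zero]
    · intro x _
      rw [add_assoc, ← Pi.single_add, sub_add_sub_cancel, sub_self, Pi.single_zero, add_zero]
  have hsum := Finset.card_eq_sum_card_fiberwise (s := (Finset.univ : Finset (Site d L))) (t := Finset.univ)
    (f := fun x : Site d L => x 0) (fun _ _ => Finset.mem_univ _)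
  have htot : (Finset.univ : Finset (Site d L)).card = L ^ d := by
    rw [Finset.card_univ, Fintype.card_fun, ZMod.card, Fintype.card_fin]
  rw [← htot, hsum, Finset.sum_congr rfl (fun b _ => hfib b), Finset.sum_const, Finset.card_univ, ZMod.card,
    smul_eq_mul]

/-- `#{x : x₀ ≠ 0} = L^d − L^{d−1}` (as `L · # = (L − 1) L^d`, division-free). [folklore] -/
theorem card_filter_apply_ne_zero :
    L * (Finset.univ.filter fun x : Site d L => x 0 ≠ 0).card = (L - 1) * L ^ d := by
  classical
  have h0 := card_filter_apply_eq (d := d) (L := L) 0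
  have htot : (Finset.univ : Finset (Site d L)).card = L ^ d := by
    rw [Finset.card_univ, Fintype.card_fun, ZMod.card, Fintype.card_fin]
  have hsplit : (Finset.univ.filter fun x : Site d L => x 0 = 0).card +
      (Finset.univ.filter fun x : Site d L => x 0 ≠ 0).card = L ^ d := by
    rw [← htot]
    exact Finset.card_filter_add_card_filter_not _
  have hL : 1 ≤ L := Nat.one_le_iff_ne_zero.2 (NeZero.ne L)
  have : L ^ d + L * (Finset.univ.filter fun x : Site d L => x 0 ≠ 0).card = L * L ^ d := by
    rw [← h0, ← mul_add, hsplit, h0]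
  rw [Nat.sub_mul, one_mul]
  omega

/-- `#{μ : μ ≠ 0} = d − 1`. [folklore] -/
theorem card_filter_ne_zero_fin : (Finset.univ.filter fun μ : Fin d => μ ≠ 0).card = d - 1 := by
  rw [Finset.filter_ne' Finset.univ (0 : Fin d), Finset.card_erase_of_mem (Finset.mem_univ _), Finset.card_univ,
    Fintype.card_fin]

/-- ★ **`L · #assigned = (d − 1)(L − 1) L^d`**, i.e. `#assigned = (d−1)(L^d − L^{d−1})`. [folklore] -/
theorem card_assigned : L * (assigned d L).card = (d - 1) * ((L - 1) * L ^ d) := by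
  rw [assigned, Finset.card_product, card_filter_ne_zero_fin, mul_comm _ (d - 1), ← mul_assoc, mul_comm L,
    mul_assoc, card_filter_apply_ne_zero]

/-- The `0`-coordinate of `x + e_0` has value `≠ k` when that of `x` is `≥ k ≥ 1`. [folklore] -/
theorem val_shift_zero_ne {x : Site d L} {k : ℕ} (hk : k ≠ 0) (hx : k ≤ (x 0).val) :
    ((x.shift 0) 0).val ≠ k := by
  intro h
  have hshift : (x.shift 0) 0 = x 0 + 1 := by
    simp [Literature.MathematicalPhysics.QuantumFieldTheory.Site.shift]
  rw [hshift, ZMod.val_add, ZMod.val_one_eq_one_mod] at h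
  have hlt := ZMod.val_lt (x 0)
  rcases Nat.eq_or_lt_of_le (Nat.one_le_iff_ne_zero.2 (NeZero.ne L)) with hL | hL
  · -- `L = 1`: every value is `0`
    have : (x 0).val = 0 := by omega
    omega
  · rw [Nat.mod_eq_of_lt hL] at h
    rcases Nat.lt_or_ge ((x 0).val + 1) L with h1 | h1
    · rw [Nat.mod_eq_of_lt h1] at h
      omega
    · have heq : (x 0).val + 1 = L := by omega
      rw [heq, Nat.mod_self] at h
      exact hk h.symm

end Count

/-! ### The one-plaquette weight, the peeling map and the peeled weights (algebra) -/

section Algebra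

variable {d L N : ℕ} [NeZero d] {G : Type*} [Group G] (ρ : G →* Matrix (Fin N) (Fin N) ℂ)

/-- The one-plaquette Boltzmann weight `f(g) = e^{−β(N − Re tr ρ(g))}`. -/
def weight (β : ℝ) (g : G) : ℝ := Real.exp (-β * ((N : ℝ) - (ρ g).trace.re))

/-- `f > 0`. -/
theorem weight_pos (β : ℝ) (g : G) : 0 < weight ρ β g := Real.exp_pos _

omit [NeZero d] in
/-- `e^{−βS} = ∏_P f(U_P)`. [folklore] -/
theorem exp_neg_mul_wilsonAction [NeZero L] (β : ℝ) (U : GaugeConfig d L G) :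
    Real.exp (-β * wilsonAction ρ U) = ∏ P : Plaquette d L, weight ρ β (plaquetteHolonomy U P.1 P.2.1.1 P.2.1.2) := by
  unfold wilsonAction weight
  rw [Finset.mul_sum, Real.exp_sum]

/-- The right multiplier turning `U(x,μ)` into the inverse holonomy of the plaquette `(x; 0, μ)`:
`U(x+e_μ, 0) U(x+e_0, μ)⁻¹ U(x, 0)⁻¹`. -/
def tailOf (U : GaugeConfig d L G) (e : Edge d L) : G :=
  U (e.1.shift e.2, 0) * (U (e.1.shift 0, e.2))⁻¹ * (U (e.1, 0))⁻¹

/-- `U(x,μ) · tailOf = (U_{x;0,μ})⁻¹`. [folklore] -/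
theorem mul_tailOf (U : GaugeConfig d L G) (e : Edge d L) :
    U e * tailOf U e = (plaquetteHolonomy U e.1 0 e.2)⁻¹ := by
  unfold tailOf plaquetteHolonomy
  simp only [mul_inv_rev, inv_inv, mul_assoc]

open Classical in
/-- The peeling map of layer `k`: every layer-`k` link variable is replaced by the inverse holonomy of
its plaquette; all other links are unchanged. -/
def peelMap (k : ℕ) (U : GaugeConfig d L G) : GaugeConfig d L G :=
  fun e => if e ∈ layer d L k then U e * tailOf U e else U e

/-- Links outside the layer are untouched. -/
theorem peelMap_apply_of_not_mem {k : ℕ} {U : GaugeConfig d L G} {e : Edge d L} (h : e ∉ layer d L k) :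
    peelMap k U e = U e := by
  classical
  exact if_neg h

/-- Links of the layer become inverse holonomies. -/
theorem peelMap_apply_of_mem {k : ℕ} {U : GaugeConfig d L G} {e : Edge d L} (h : e ∈ layer d L k) :
    peelMap k U e = U e * tailOf U e := by
  classical
  exact if_pos h

/-- The weight after peeling the layers `1, …, k`: one-link weights on the assigned links with `x₀ ≤ k`,
plaquette weights on the others. -/
def peelWeight [NeZero L] (β : ℝ) (k : ℕ) (U : GaugeConfig d L G) : ℝ :=
  ∏ e ∈ assigned d L, if (e.1 0).val ≤ k then weight ρ β (U e) else weight ρ β (plaquetteHolonomy U e.1 0 e.2)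

/-- `0 ≤ peelWeight`. -/
theorem peelWeight_nonneg [NeZero L] (β : ℝ) (k : ℕ) (U : GaugeConfig d L G) : 0 ≤ peelWeight ρ β k U :=
  Finset.prod_nonneg fun e _ => by split_ifs <;> exact (weight_pos ρ β _).le

/-- Before any peeling: the product of the assigned plaquette weights. -/
theorem peelWeight_zero [NeZero L] (β : ℝ) (U : GaugeConfig d L G) :
    peelWeight ρ β 0 U = ∏ e ∈ assigned d L, weight ρ β (plaquetteHolonomy U e.1 0 e.2) := by
  unfold peelWeight
  refine Finset.prod_congr rfl fun e he => ?_
  have h : ¬ (e.1 0).val ≤ 0 := by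
    have := (mem_assigned.1 he).1
    rw [ne_eq, ← ZMod.val_eq_zero] at this
    omega
  rw [if_neg h]

/-- After peeling all `L − 1` layers: the product of one-link weights on the assigned links. -/
theorem peelWeight_top [NeZero L] (β : ℝ) (U : GaugeConfig d L G) :
    peelWeight ρ β L U = ∏ e ∈ assigned d L, weight ρ β (U e) := by
  unfold peelWeight
  refine Finset.prod_congr rfl fun e _ => ?_
  rw [if_pos (ZMod.val_lt (e.1 0)).le]

/-- **Dropping the unassigned plaquettes**: `e^{−βS} ≤ peelWeight 0` when `f ≤ 1`. [folklore] -/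
theorem exp_neg_mul_wilsonAction_le_peelWeight_zero [NeZero L] {β : ℝ} (hw : ∀ g, weight ρ β g ≤ 1)
    (U : GaugeConfig d L G) : Real.exp (-β * wilsonAction ρ U) ≤ peelWeight ρ β 0 U := by
  classical
  rw [exp_neg_mul_wilsonAction, peelWeight_zero]
  -- the assigned plaquettes, described intrinsically
  set T : Finset (Plaquette d L) := Finset.univ.filter fun P => P.1 0 ≠ 0 ∧ P.2.1.1 = 0 with hT
  have hsplit := Finset.prod_mul_prod_compl T (fun P : Plaquette d L => weight ρ β (plaquetteHolonomy U P.1 P.2.1.1 P.2.1.2))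
  rw [← hsplit]
  have hcompl : ∏ P ∈ Tᶜ, weight ρ β (plaquetteHolonomy U P.1 P.2.1.1 P.2.1.2) ≤ 1 :=
    Finset.prod_le_one (fun P _ => (weight_pos ρ β _).le) fun P _ => hw _
  have hT' : ∏ P ∈ T, weight ρ β (plaquetteHolonomy U P.1 P.2.1.1 P.2.1.2) =
      ∏ e ∈ assigned d L, weight ρ β (plaquetteHolonomy U e.1 0 e.2) := by
    refine Finset.prod_bij' (fun P _ => (P.1, P.2.1.2))
      (fun e he => (e.1, ⟨((0 : Fin d), e.2), by
        simpa only using ((Fin.pos_iff_ne_zero' e.2).2 (mem_assigned.1 he).2 : (0 : Fin d) < e.2)⟩))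
      ?_ ?_ ?_ ?_ ?_
    · intro P hP
      rw [hT, Finset.mem_filter] at hP
      rw [mem_assigned]
      refine ⟨hP.2.1, ?_⟩
      have h := P.2.2
      rw [hP.2.2] at h
      exact h.ne'
    · intro e he
      rw [hT, Finset.mem_filter]
      exact ⟨Finset.mem_univ _, (mem_assigned.1 he).1, rfl⟩
    · intro P hP
      rw [hT, Finset.mem_filter] at hP
      obtain ⟨x, ⟨⟨i, j⟩, hij⟩⟩ := P
      simp only at hP
      obtain ⟨-, -, rfl⟩ := hP
      rfl
    · intro e he; rfl
    · intro P hP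
      rw [hT, Finset.mem_filter] at hP
      rw [hP.2.2]
  rw [hT']
  exact mul_le_of_le_one_right (Finset.prod_nonneg fun e _ => (weight_pos ρ β _).le) hcompl

end Algebra

end Peel

end Summit.QuantumFields.GaugeBoot

end
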